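import Summits.ABC.StewartYu.GenThreeInductionArch
import Summits.ABC.StewartYu.GenThreeStepTwo
import HarnessLib

/-!
# Cell abc-stewartyu, WP-L.A shell (parcel P-A1): the MATVEEV STEP at the archimedean place — from the zero
# estimate's exit C to the second branch of `DichotomyArch`, every shape hypothesis discharged, closed
# against ONE numeric line of the record (Nesterenko 2003, Prop. 2.6 / (5.22))

`Summits/ABC/StewartYu/GenThreeStepArch.lean` — cell `abc-stewartyu` (HOME `run/shared/lean/pub/abc-stewartyu/`),
route `YuMatveevShapeRat` (rung A1.L, crux r2 `ArchCoreRat`), seat p4 (g9), parcel WP-L.A P-A1; the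
ARCHIMEDEAN TWIN of `Summits/ABC/StewartYu/GenThreeStepOdd.lean` (p4-g3) and of p3's Kummer-free
`GenThreeStepTwoRat` shell.  Theorems only (composition of landed bricks); no definition, no named fact.

After the frame's extrapolation and the zero estimate, exit C of Nesterenko's §5.2 hands the obstruction
subgroup `H` with a `ℤ`-basis `M` of `Φ = H.chars` (`r` independent rows, `0 < r < n`) and
`b ∈ span_ℚ(rows M)`.  From this datum `Summit.ABC.StewartYu.MatveevStepData.exists_matveev_step_data` —
at the TRIVIAL Kummer exponent `q = 1`, the crux `ArchCoreRat` being Kummer-free — produces the re-based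
basis `Z` of `Φ`, the relation `m₀ b = ∑ mᵢ Zᵢ` and the Cramer–Hadamard bounds (Prop. 2.6 (2.9)–(2.13), with
the re-basing factor `(r!)²nʳ` in place of Minkowski's `2^ν/V(𝔎)`).  THIS FILE turns that output into the
rank-`r` datum of the internal statement `GenThreeInductionArch.CoreArch C r`: new generators
`θᵢ = ∏ⱼ aⱼ^{Zᵢⱼ}` (positive rationals), weights `A′ᵢ := ‖Zᵢ‖_A = ∑ⱼ Aⱼ|Zᵢⱼ|`, exponents `m ≠ 0`, and
DISCHARGES every shape hypothesis: positivity, multiplicative independence, `h(θᵢ) ≤ A′ᵢ`, `1 ≤ A′ᵢ`, the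
algebraic relation `∏ θᵢ^{mᵢ} = (∏ aⱼ^{bⱼ})^{m₀}` (`m₀ ≠ 0`, so `Λ′ = m₀Λ`), and the size data
`∏ A′ᵢ ≤ P(κ) := (r!)²·nʳ·|det M_κ|·∏ᵢ A_{κ i}` for a non-singular maximal weighted minor `κ`,
`|m₀| ≤ ∏ A′ᵢ`, `|mⱼ| ≤ r·B·∏_{i≠j} A′ᵢ` ((2.11)/(2.12): `|m₀|·∏A_κ′ ≤ ∏A′`,
`|mⱼ|·∏A_κ′ ≤ (∑ A_κ′|b_κ′|)·∏_{i≠j}A′ᵢ`).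

`exists_step_generators_arch` is that package.  `stepArch_of_exitC` then closes
`GenThreeInductionArch.StepArch` with the canonical choices `B′ := n·B·P(κ)`, `D := log|m₀| ≤ log P(κ)`
against ONE numeric hypothesis on the record's side, uniformly in the minor `κ`:
`C(r)·P(κ)·(log(eB) + log n + log P(κ)) + log P(κ) ≤ C(n)·∏A·log(eB)` — the archimedean (5.22) line
(`log(e·nBP) = log(eB) + log n + log P`; the record bounds `|det M_κ|` by the zero estimate's `nesterenkoH`
inequality).  So, with `GenThreeInductionArch` and `GenThreeBaseArch`, the crux `ArchCoreRat` is: the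
analytic frame at rank `n ≥ 2` under the negated bound + the record's exits A/B + this line.

WHAT THIS IS NOT: no analytic content, no numerics; no crux moves.

References: Yu. V. Nesterenko, LNM 1819 (2003), Prop. 2.6 (2.9)–(2.13) (pp. 95–96), §5.2 (5.22) (p. 131);
E. M. Matveev, Izv. Math. 64 (2000) (the induction scheme).
-/

noncomputable section

open Finset
open Literature.NumberTheory.Transcendental
open Literature.NumberTheory.Transcendental.GaGm

namespace Summit.ABC.StewartYu.GenThreeStepArch

open Summit.ABC.StewartYu.GenThreeInductionArch
open Summit.ABC.StewartYu.GenThreeStepTwo (logHeight₁_prod_zpow_le one_le_weightedNorm le_prod_of_one_le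
  prod_erase_le_prod)

variable {n r : ℕ}

/-! ### The step generators -/

/-- **The generators of Matveev's step at the archimedean place, with every shape hypothesis of the internal
statement discharged.**  From the exit-C datum of the zero estimate (`H`, a `ℤ`-basis `M` of `H.chars`,
`b ∈ span_ℚ M`) over positive rationals `aⱼ` (independent, `h(aⱼ) ≤ Aⱼ`, `1 ≤ Aⱼ`), there are a re-based
basis `Z` of `Φ`, generators `θᵢ = ∏ⱼ aⱼ^{Zᵢⱼ}`, weights `A′ᵢ = ∑ⱼ Aⱼ|Zᵢⱼ|`, exponents `m ≠ 0` and `m₀ ≠ 0`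
with: `0 < θᵢ`, independence, `h(θᵢ) ≤ A′ᵢ`, `1 ≤ A′ᵢ`, `∏ θᵢ^{mᵢ} = (∏ aⱼ^{bⱼ})^{m₀}`,
`∏ A′ᵢ ≤ (r!)²nʳ·|det M_κ|·∏ A_κ` (maximal non-singular weighted minor `κ`), `|m₀|·∏ A_κ′ ≤ ∏ A′ᵢ`,
`|mⱼ|·∏ A_κ′ ≤ (∑ A_κ′|b_κ′|)·∏_{i≠j} A′ᵢ` (no Kummer clause owed or used: `exists_matveev_step_data` at
`q = 1`). [cite: Nesterenko2003, Prop 2.6 (2.9)–(2.13) (pp. 95–96)] -/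
theorem exists_step_generators_arch (hr : 0 < r)
    (a : Fin n → ℚ) (ha : ∀ j, 0 < a j)
    (hind : ∀ μ : Fin n → ℤ, ∏ j, a j ^ μ j = 1 → μ = 0)
    (A : Fin n → ℝ) (hA : ∀ j, Height.logHeight₁ (a j) ≤ A j) (hA1 : ∀ j, 1 ≤ A j)
    (b : Fin n → ℤ) (hb : b ≠ 0)
    (H : ConnAlgSubgroup n) (M : Fin r → Fin n → ℤ) (hM : LinearIndependent ℤ M)
    (hchars : H.chars = AddSubgroup.closure (Set.range M))
    (hbM : (fun k => (b k : ℚ)) ∈ Submodule.span ℚ (Set.range fun i => fun k => (M i k : ℚ))) :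
    ∃ (Z : Fin r → Fin n → ℤ) (κ κ' : Fin r → Fin n) (θ : Fin r → ℚ) (A' : Fin r → ℝ)
      (m : Fin r → ℤ) (m₀ : ℤ),
      (∀ i, θ i = ∏ j, a j ^ Z i j) ∧ (∀ i, A' i = ∑ j, A j * |(Z i j : ℝ)|) ∧
      LinearIndependent ℤ Z ∧ Submodule.span ℤ (Set.range Z) = Submodule.span ℤ (Set.range M) ∧
      (∀ i, 0 < θ i) ∧
      (∀ μ : Fin r → ℤ, ∏ i, θ i ^ μ i = 1 → μ = 0) ∧
      (∀ i, Height.logHeight₁ (θ i) ≤ A' i) ∧ (∀ i, 1 ≤ A' i) ∧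
      m ≠ 0 ∧ m₀ ≠ 0 ∧ ∏ i, θ i ^ m i = (∏ j, a j ^ b j) ^ m₀ ∧
      Function.Injective κ ∧ (Matrix.of fun i j => (M j (κ i) : ℝ)).det ≠ 0 ∧
      (∀ κ₁ : Fin r → Fin n,
        |(Matrix.of fun i j => (M j (κ₁ i) : ℝ)).det| * ∏ i, A (κ₁ i) ≤
          |(Matrix.of fun i j => (M j (κ i) : ℝ)).det| * ∏ i, A (κ i)) ∧
      ∏ i, A' i ≤ ((r.factorial : ℝ)) ^ 2 * (n : ℝ) ^ r *
          (|(Matrix.of fun i j => (M j (κ i) : ℝ)).det| * ∏ i, A (κ i)) ∧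
      Function.Injective κ' ∧ (|m₀| : ℝ) * ∏ i, A (κ' i) ≤ ∏ i, A' i ∧
      (∀ j, (|m j| : ℝ) * ∏ i, A (κ' i) ≤
        (∑ i, A (κ' i) * |(b (κ' i) : ℝ)|) * ∏ i ∈ univ.erase j, A' i) := by
  classical
  have ha0 : ∀ j, a j ≠ 0 := fun j => (ha j).ne'
  have hA0 : ∀ j, 0 < A j := fun j => by linarith [hA1 j]
  -- the trivial Kummer condition at exponent `q = 1`
  have hK1 : ∀ φ : Fin n → ℤ, (∃ γ : ℚ, ∏ j, a j ^ φ j = γ ^ 1) → ∀ j, ((1 : ℕ) : ℤ) ∣ φ j :=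
    fun φ _ j => by simp
  obtain ⟨Z, κ, m₀, mm, κ', hZli, hZspan, hκ, hdet, hmax, hprod, hκ', hm₀, hrel, hm₀le, hmle, hθK⟩ :=
    Summit.ABC.StewartYu.MatveevStepData.exists_matveev_step_data (K := ℚ) 1 le_rfl hr hA0 a ha0
      hind hK1 H M hM hchars b hbM
  set θ : Fin r → ℚ := fun i => ∏ j, a j ^ Z i j with hθdef
  set A' : Fin r → ℝ := fun i => ∑ j, A j * |(Z i j : ℝ)| with hA'def
  have hθ : ∀ i, θ i = ∏ j, a j ^ Z i j := fun i => rfl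
  obtain ⟨hindθ, _⟩ := hθK θ hθ
  have hZne : ∀ i, Z i ≠ 0 := fun i => hZli.ne_zero i
  have hrelθ : ∏ i, θ i ^ mm i = (∏ j, a j ^ b j) ^ m₀ := by
    rw [Summit.ABC.StewartYu.KummerBasisChange.prod_zpow_basisChange a ha0 Z θ hθ mm, ← Finset.prod_zpow]
    refine Finset.prod_congr rfl fun j _ => ?_
    rw [← zpow_mul, mul_comm (b j) m₀, hrel j]
  have hmm : mm ≠ 0 := by
    intro h0
    apply hb
    funext k
    have h1 := hrel k
    rw [h0] at h1
    simp only [Pi.zero_apply, zero_mul, Finset.sum_const_zero, mul_eq_zero] at h1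
    rcases h1 with h1 | h1
    · exact absurd h1 hm₀
    · simpa using h1
  refine ⟨Z, κ, κ', θ, A', mm, m₀, hθ, fun i => rfl, hZli, hZspan, ?_, hindθ, ?_, ?_, hmm, hm₀, hrelθ,
    hκ, hdet, hmax, hprod, hκ', hm₀le, hmle⟩
  · intro i
    exact prod_zpow_pos a ha (Z i)
  · intro i
    exact logHeight₁_prod_zpow_le a A hA (Z i)
  · intro i
    exact one_le_weightedNorm A hA1 (Z i) (hZne i)

/-! ### Elementary inequalities for the canonical `B′` -/

/-- For reals `xᵢ ≥ 1` on `Fin r`: `∑ xᵢ ≤ r · ∏ xᵢ` (each summand is at most the product). [folklore] -/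
theorem sum_le_card_mul_prod {x : Fin r → ℝ} (hx : ∀ i, 1 ≤ x i) : ∑ i, x i ≤ (r : ℝ) * ∏ i, x i := by
  calc ∑ i, x i ≤ ∑ _i : Fin r, ∏ k, x k := Finset.sum_le_sum fun i _ => le_prod_of_one_le hx i
    _ = (r : ℝ) * ∏ i, x i := by
        rw [Finset.sum_const, Finset.card_univ, Fintype.card_fin, nsmul_eq_mul]

/-- `log(e·(n·B·P)) = log(eB) + log n + log P` for positive `n, B, P`. [folklore] -/
theorem log_exp_one_mul_mul {x B P : ℝ} (hx : 0 < x) (hB : 0 < B) (hP : 0 < P) :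
    Real.log (Real.exp 1 * (x * B * P)) = Real.log (Real.exp 1 * B) + Real.log x + Real.log P := by
  have he : Real.exp 1 ≠ 0 := (Real.exp_pos 1).ne'
  rw [Real.log_mul he (by positivity), Real.log_mul (by positivity) hP.ne', Real.log_mul hx.ne' hB.ne',
    Real.log_mul he hB.ne']
  ring

/-! ### The step, closed against the record's (5.22) line -/

/-- **The Matveev step at the archimedean place closed against ONE numeric line** (third clause of the
archimedean record, uniformly in the non-singular maximal weighted minor `κ`):
`C(r)·P(κ)·(log(eB) + log n + log P(κ)) + log P(κ) ≤ C(n)·∏A·log(eB)`,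
`P(κ) = (r!)²nʳ·|det M_κ|·∏A_κ`, gives `StepArch C n a b A B`.
(Choices: `B′ := n·B·P(κ)`, `D := log|m₀|`; uses `∏A′ ≤ P`, `|m₀| ≤ P`, `|mⱼ| ≤ n·B·P`.)
[cite: Nesterenko2003, Prop 2.6 (2.11)–(2.13) (p. 96), §5.2 (5.22) (p. 131)] -/
theorem stepArch_of_exitC {C : ℕ → ℝ} (hr : 0 < r) (hrn : r < n) (hCr : 0 ≤ C r)
    (a : Fin n → ℚ) (ha : ∀ j, 0 < a j)
    (hind : ∀ μ : Fin n → ℤ, ∏ j, a j ^ μ j = 1 → μ = 0)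
    (A : Fin n → ℝ) (hA : ∀ j, Height.logHeight₁ (a j) ≤ A j) (hA1 : ∀ j, 1 ≤ A j)
    (b : Fin n → ℤ) (hb : b ≠ 0) {B : ℝ} (hB : ∀ j, (|b j| : ℝ) ≤ B)
    (H : ConnAlgSubgroup n) (M : Fin r → Fin n → ℤ) (hM : LinearIndependent ℤ M)
    (hchars : H.chars = AddSubgroup.closure (Set.range M))
    (hbM : (fun k => (b k : ℚ)) ∈ Submodule.span ℚ (Set.range fun i => fun k => (M i k : ℚ)))
    (hcost : ∀ κ : Fin r → Fin n, Function.Injective κ →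
      (Matrix.of fun i j => (M j (κ i) : ℝ)).det ≠ 0 →
      C r * (((r.factorial : ℝ)) ^ 2 * (n : ℝ) ^ r *
              (|(Matrix.of fun i j => (M j (κ i) : ℝ)).det| * ∏ i, A (κ i))) *
          (Real.log (Real.exp 1 * B) + Real.log n +
            Real.log (((r.factorial : ℝ)) ^ 2 * (n : ℝ) ^ r *
              (|(Matrix.of fun i j => (M j (κ i) : ℝ)).det| * ∏ i, A (κ i)))) +
        Real.log (((r.factorial : ℝ)) ^ 2 * (n : ℝ) ^ r *
              (|(Matrix.of fun i j => (M j (κ i) : ℝ)).det| * ∏ i, A (κ i))) ≤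
        C n * (∏ j, A j) * Real.log (Real.exp 1 * B)) :
    StepArch C n a b A B := by
  classical
  obtain ⟨Z, κ, κ', θ, A', m, m₀, hθ, hA', _hZli, _hZspan, hθpos, hindθ, hhA', hA1', _hm, hm₀, hrel, hκ,
    hdet, _hmax, hprod, hκ', hm₀le, hmle⟩ :=
    exists_step_generators_arch hr a ha hind A hA hA1 b hb H M hM hchars hbM
  set P : ℝ := ((r.factorial : ℝ)) ^ 2 * (n : ℝ) ^ r *
      (|(Matrix.of fun i j => (M j (κ i) : ℝ)).det| * ∏ i, A (κ i)) with hPdef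
  have hn1 : (1 : ℝ) ≤ n := by
    have : 1 ≤ n := by omega
    exact_mod_cast this
  have hr1 : (r : ℝ) ≤ n := by exact_mod_cast hrn.le
  have hB1 : 1 ≤ B := one_le_bound hb hB
  have hprodA'1 : 1 ≤ ∏ i, A' i := Finset.one_le_prod fun i _ => hA1' i
  have hP1 : 1 ≤ P := hprodA'1.trans hprod
  have hP0 : 0 < P := by linarith
  have hAκ'1 : ∀ i, 1 ≤ A (κ' i) := fun i => hA1 _
  have hprodκ'1 : 1 ≤ ∏ i, A (κ' i) := Finset.one_le_prod fun i _ => hAκ'1 i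
  have hprodκ'0 : 0 < ∏ i, A (κ' i) := by linarith
  -- `|m₀| ≤ ∏ A′ ≤ P`
  have hm₀P : (|m₀| : ℝ) ≤ P := by
    have h1 : (|m₀| : ℝ) ≤ (|m₀| : ℝ) * ∏ i, A (κ' i) := by
      calc (|m₀| : ℝ) = (|m₀| : ℝ) * 1 := by ring
        _ ≤ (|m₀| : ℝ) * ∏ i, A (κ' i) := mul_le_mul_of_nonneg_left hprodκ'1 (abs_nonneg _)
    exact h1.trans (hm₀le.trans hprod)
  -- `∑ A_κ′|b_κ′| ≤ B · r · ∏ A_κ′`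
  have hsum : ∑ i, A (κ' i) * |(b (κ' i) : ℝ)| ≤ B * ((r : ℝ) * ∏ i, A (κ' i)) := by
    calc ∑ i, A (κ' i) * |(b (κ' i) : ℝ)| ≤ ∑ i, A (κ' i) * B :=
          Finset.sum_le_sum fun i _ => mul_le_mul_of_nonneg_left (hB _) (by linarith [hAκ'1 i])
      _ = B * ∑ i, A (κ' i) := by rw [← Finset.sum_mul, mul_comm]
      _ ≤ B * ((r : ℝ) * ∏ i, A (κ' i)) :=
          mul_le_mul_of_nonneg_left (sum_le_card_mul_prod hAκ'1) (by linarith)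
  -- `|mⱼ| ≤ n·B·P`
  have hmj : ∀ j, (|m j| : ℝ) ≤ (n : ℝ) * B * P := by
    intro j
    have h1 := hmle j
    have h2 : ∏ i ∈ univ.erase j, A' i ≤ P := (prod_erase_le_prod hA1' j).trans hprod
    have h2' : 0 ≤ ∏ i ∈ univ.erase j, A' i := Finset.prod_nonneg fun i _ => by linarith [hA1' i]
    -- `|mⱼ|·∏A_κ′ ≤ B·r·∏A_κ′·P`
    have h3 : (|m j| : ℝ) * ∏ i, A (κ' i) ≤ (B * (r : ℝ) * P) * ∏ i, A (κ' i) := by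
      calc (|m j| : ℝ) * ∏ i, A (κ' i)
          ≤ (∑ i, A (κ' i) * |(b (κ' i) : ℝ)|) * ∏ i ∈ univ.erase j, A' i := h1
        _ ≤ (B * ((r : ℝ) * ∏ i, A (κ' i))) * P :=
            mul_le_mul hsum h2 h2' (by positivity)
        _ = (B * (r : ℝ) * P) * ∏ i, A (κ' i) := by ring
    have h4 : (|m j| : ℝ) ≤ B * (r : ℝ) * P := le_of_mul_le_mul_right h3 hprodκ'0
    calc (|m j| : ℝ) ≤ B * (r : ℝ) * P := h4
      _ ≤ B * (n : ℝ) * P := by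
          have : 0 ≤ B * P := by positivity
          nlinarith
      _ = (n : ℝ) * B * P := by ring
  -- the canonical `B′` and the cost line
  set B' : ℝ := (n : ℝ) * B * P with hB'def
  have hlogB' : Real.log (Real.exp 1 * B') = Real.log (Real.exp 1 * B) + Real.log n + Real.log P := by
    rw [hB'def]; exact log_exp_one_mul_mul (by linarith) (by linarith) hP0
  have hlogB0 : 0 ≤ Real.log (Real.exp 1 * B) := zero_le_one.trans (one_le_log_exp_one_mul hB1)
  have hlogn0 : 0 ≤ Real.log n := Real.log_nonneg hn1
  have hlogP0 : 0 ≤ Real.log P := Real.log_nonneg hP1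
  have hD : Real.log |(m₀ : ℝ)| ≤ Real.log P := by
    have h0 : (0 : ℝ) < |(m₀ : ℝ)| := abs_pos.mpr (by exact_mod_cast hm₀)
    have : Real.log |(m₀ : ℝ)| ≤ Real.log P := Real.log_le_log h0 (by exact_mod_cast hm₀P)
    exact this
  have hcostκ := hcost κ hκ hdet
  have hfinal : C r * (∏ i, A' i) * Real.log (Real.exp 1 * B') + Real.log |(m₀ : ℝ)| ≤
      C n * (∏ j, A j) * Real.log (Real.exp 1 * B) := by
    have hL0 : 0 ≤ Real.log (Real.exp 1 * B) + Real.log n + Real.log P := by linarith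
    have h1 : C r * (∏ i, A' i) * Real.log (Real.exp 1 * B') ≤
        C r * P * (Real.log (Real.exp 1 * B) + Real.log n + Real.log P) := by
      rw [hlogB']
      have : C r * (∏ i, A' i) ≤ C r * P := mul_le_mul_of_nonneg_left hprod hCr
      exact mul_le_mul_of_nonneg_right this hL0
    have h2 : C r * P * (Real.log (Real.exp 1 * B) + Real.log n + Real.log P) + Real.log P ≤
        C n * (∏ j, A j) * Real.log (Real.exp 1 * B) := hcostκ
    linarith
  exact stepArch_of_pow_eq ha hind hb hrn θ m A' B' hθpos hindθ hhA' hA1' hmj m₀ hm₀ hrel hfinal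

end Summit.ABC.StewartYu.GenThreeStepArch

end
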